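import Summits.Ventures.Crystal3D.Bulk.GapDarts
import Summits.Ventures.Crystal3D.Bulk.GapCensusRowsStar
import HarnessLib

/-!
# Face corners of the two-level tight map: the corner of a face at a dart is the vertex gap
# (`phase2/LEAN-FACES-DESIGN.md` (F1b))

HONEST FRAMING. Part of the venture `Summits/Ventures/Crystal3D` (cell `pub-crystal3d`, phase 2;
seat typer-bulk-2). `Bulk/GapVertexStar.lean` has the LP's corner variables at a vertex `i` as
the gaps `tightGap c i hd m` between azimuth-consecutive tight partners, indexed by a POSITION
`m : Fin (k+1)` under a presentation `hd : #tightAngles = k + 1`; `Bulk/GapDarts.lean` has the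
combinatorial map (darts, vertex rotation `nextNbr`, face successor `faceSucc`) indexed by the
PARTNERS themselves. The census LP indexes its corner variables by (vertex, face) = by darts. This
file bridges the two indexings, with no dependent-type bookkeeping left for the user:

* `dartGap c i j` — the counter-clockwise angle at the vertex `gapDir c i` from the tight arc
  `i → j` to the next tight arc `i → nextNbr c i j` (azimuth difference normalised into
  `(0, 2π]`); `dartGap_pos`, `dartGap_le_two_pi` (unconditional);
* `dartGap_tightNbrAt`: at the partner in position `m` it IS `tightGap c i hd m` (any
  presentation `hd`); `nextNbr_tightNbrAt` (the rotation steps to position `m + 1`); the index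
  transport lemmas `tightNbrAt_cast`, `tightGap_cast`;
* `IsGapConfig.sum_dartGap` (**R-sum by partners**: `Σ_{j ∈ tightNbrs c i} dartGap c i j = 2π`
  at every vertex with a tight partner; admissible, `D² < 3`), `IsGapConfig.dartGap_eq_corner`
  (a gap `≤ π` is the corner `corner c i (nextNbr c i j) j` of `Bulk/GapCorners.lean`),
  `IsGapConfig.nextNbr_mem_tightNbrs`, `IsGapConfig.nextNbr_ne_self` (degree `≥ 2`);
* under the census socket `CensusRows c` (`Bulk/GapCensusRows.lean`): `CensusRows.dartGap_lt_pi`,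
  `CensusRows.dartGap_eq_corner`, `CensusRows.sum_dartGap`, and the R-min rows in dart form
  `CensusRows.arccos_third_le_dartGap` / `arccos_Ax_le_dartGap` / `arccos_Ax_le_dartGap'` /
  `arccos_Ap_le_dartGap`;
* `faceCorner c q := dartGap c q.2 q.1` — the corner of the face through the dart `q = (i, j)` at
  its head `j` (between the incoming arc `j → i` and the outgoing arc of the face walk,
  `faceCorner_eq_corner_faceSucc`), `activeVertices c` (balls `≠ 0` with a tight partner) and
  **`IsGapConfig.sum_faceCorner`**: `Σ_{q ∈ darts c} faceCorner c q = 2π · #activeVertices` —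
  the angle bookkeeping `Σ_faces Σ_corners = 2π V′` behind Euler / Gauss–Bonnet for the tight map.

Nothing is claimed about GAP(1.26); faces as orbits and Euler's formula (F2) are NOT here.
-/

noncomputable section

open scoped BigOperators InnerProductSpace
open Finset Real

namespace Summit.Ventures.Crystal3D

open Literature.Geometry.DiscreteGeometry

variable {c : Fin 14 → EuclideanSpace ℝ (Fin 3)}

/-! ## Index transport between presentations `#tightAngles = d` -/

/-- `Fin.cast` commutes with `finRotate`. -/
theorem cast_finRotate {n n' : ℕ} (h : n = n') (m : Fin n) :
    Fin.cast h (finRotate n m) = finRotate n' (Fin.cast h m) := by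
  subst h
  rfl

/-- `tightNbrAt` does not depend on the presentation of the number of partners. -/
theorem tightNbrAt_cast (i : Fin 14) {d d' : ℕ} (hd : (tightAngles c i).card = d)
    (hd' : (tightAngles c i).card = d') (m : Fin d) :
    tightNbrAt c i hd m = tightNbrAt c i hd' (Fin.cast (hd.symm.trans hd') m) := by
  subst hd
  subst hd'
  rfl

/-- `sortedTightAngle` does not depend on the presentation of the number of partners. -/
theorem sortedTightAngle_cast (i : Fin 14) {d d' : ℕ} (hd : (tightAngles c i).card = d)
    (hd' : (tightAngles c i).card = d') (m : Fin d) :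
    sortedTightAngle c i hd m = sortedTightAngle c i hd' (Fin.cast (hd.symm.trans hd') m) := by
  subst hd
  subst hd'
  rfl

/-- `tightGap` does not depend on the presentation `k + 1` of the number of partners. -/
theorem tightGap_cast (i : Fin 14) {k k' : ℕ} (hd : (tightAngles c i).card = k + 1)
    (hd' : (tightAngles c i).card = k' + 1) (m : Fin (k + 1)) :
    tightGap c i hd m = tightGap c i hd' (Fin.cast (hd.symm.trans hd') m) := by
  obtain rfl : k = k' := by omega
  rfl

/-- **The vertex rotation steps to the next position**: for ANY presentation
`hd : #tightAngles = k + 1`, `nextNbr c i (tightNbrAt m) = tightNbrAt (m + 1)` (cyclically). -/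
theorem nextNbr_tightNbrAt {i : Fin 14} {k : ℕ} (hd : (tightAngles c i).card = k + 1)
    (m : Fin (k + 1)) :
    nextNbr c i (tightNbrAt c i hd m) = tightNbrAt c i hd (finRotate (k + 1) m) := by
  rw [tightNbrAt_cast i hd rfl m, nextNbr_eq_of_tightNbrAt, tightNbrAt_cast i rfl hd,
    cast_finRotate]
  rfl

/-! ## The gap after a partner, indexed by the partner -/

/-- **The gap at vertex `i` following the partner `j`**: the counter-clockwise angle at
`gapDir c i` from the tight arc towards `j` to the next tight arc (towards `nextNbr c i j`), i.e.
the azimuth difference normalised into `(0, 2π]` (a lone partner gets the full turn `2π`; for a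
non-partner `j` the value is the junk `2π`). This is the LP's corner variable at the vertex `i`
in the face to the left of the dart `j → i`. -/
def dartGap (c : Fin 14 → EuclideanSpace ℝ (Fin 3)) (i j : Fin 14) : ℝ :=
  if tightAzimuth c i j < tightAzimuth c i (nextNbr c i j) then
    tightAzimuth c i (nextNbr c i j) - tightAzimuth c i j
  else tightAzimuth c i (nextNbr c i j) - tightAzimuth c i j + 2 * π

/-- Every gap is positive (unconditionally: azimuths lie in `(−π, π]`). -/
theorem dartGap_pos (c : Fin 14 → EuclideanSpace ℝ (Fin 3)) (i j : Fin 14) : 0 < dartGap c i j := by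
  have h1 := neg_pi_lt_tightAzimuth c i j
  have h2 := tightAzimuth_le_pi c i j
  have h3 := neg_pi_lt_tightAzimuth c i (nextNbr c i j)
  have h4 := tightAzimuth_le_pi c i (nextNbr c i j)
  unfold dartGap
  split_ifs with h <;> linarith

/-- Every gap is at most `2π`. -/
theorem dartGap_le_two_pi (c : Fin 14 → EuclideanSpace ℝ (Fin 3)) (i j : Fin 14) :
    dartGap c i j ≤ 2 * π := by
  have h1 := neg_pi_lt_tightAzimuth c i j
  have h2 := tightAzimuth_le_pi c i j
  have h3 := neg_pi_lt_tightAzimuth c i (nextNbr c i j)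
  have h4 := tightAzimuth_le_pi c i (nextNbr c i j)
  unfold dartGap
  split_ifs with h <;> linarith

/-- **The partner-indexed gap is the position-indexed gap**: at the partner in position `m`
(any presentation `hd : #tightAngles = k + 1`), `dartGap c i (tightNbrAt m) = tightGap c i hd m`. -/
theorem dartGap_tightNbrAt {i : Fin 14} {k : ℕ} (hd : (tightAngles c i).card = k + 1)
    (m : Fin (k + 1)) : dartGap c i (tightNbrAt c i hd m) = tightGap c i hd m := by
  have hmono := (sortedTightAngle c i hd).strictMono
  unfold dartGap tightGap
  rw [nextNbr_tightNbrAt hd m, tightAzimuth_tightNbrAt, tightAzimuth_tightNbrAt]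
  by_cases hm : m = Fin.last k
  · subst hm
    rw [finRotate_last, if_pos rfl]
    have hle : sortedTightAngle c i hd 0 ≤ sortedTightAngle c i hd (Fin.last k) :=
      hmono.monotone (Fin.zero_le _)
    rw [if_neg (not_lt.2 hle)]
  · rw [if_neg hm, add_zero, finRotate_apply]
    have hlt : m < Fin.last k := lt_of_le_of_ne (Fin.le_last m) hm
    have hlt' : m < m + 1 := Fin.lt_add_one_iff.2 hlt
    rw [if_pos (hmono hlt')]

/-- A nonempty set of tight partners has `k + 1` azimuths for some `k` (admissible, `D² < 3`). -/
theorem IsGapConfig.exists_card_tightAngles_eq_succ (hc : IsGapConfig c)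
    (hD3 : intruderDist c ^ 2 < 3) {i : Fin 14} (hi0 : i ≠ 0) (hne : (tightNbrs c i).Nonempty) :
    ∃ k : ℕ, (tightAngles c i).card = k + 1 := by
  obtain ⟨k, hk⟩ := Nat.exists_eq_succ_of_ne_zero (Finset.card_ne_zero.2 hne)
  exact ⟨k, (hc.card_tightAngles hD3 hi0).trans hk⟩

/-- **Row R-sum indexed by partners**: at a vertex `i ≠ 0` with a tight partner, the gaps
following the partners sum to `2π` (admissible configuration, `intruderDist² < 3`). -/
theorem IsGapConfig.sum_dartGap (hc : IsGapConfig c) (hD3 : intruderDist c ^ 2 < 3) {i : Fin 14}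
    (hi0 : i ≠ 0) (hne : (tightNbrs c i).Nonempty) :
    ∑ j ∈ tightNbrs c i, dartGap c i j = 2 * π := by
  obtain ⟨k, hd⟩ := hc.exists_card_tightAngles_eq_succ hD3 hi0 hne
  rw [← sum_tightGap c i hd]
  symm
  refine Finset.sum_nbij (fun m => tightNbrAt c i hd m) (fun m _ => tightNbrAt_mem c i hd m)
    (fun m _ m' _ h => tightNbrAt_injective c i hd h) ?_ (fun m _ => (dartGap_tightNbrAt hd m).symm)
  intro j hj
  obtain ⟨m, hm⟩ := hc.exists_tightNbrAt_eq hD3 hi0 hd (Finset.mem_coe.1 hj)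
  exact ⟨m, Finset.mem_coe.2 (Finset.mem_univ _), hm⟩

/-- The next partner is a tight partner (admissible, `D² < 3`). -/
theorem IsGapConfig.nextNbr_mem_tightNbrs (hc : IsGapConfig c) (hD3 : intruderDist c ^ 2 < 3)
    {i j : Fin 14} (hi0 : i ≠ 0) (hj : j ∈ tightNbrs c i) : nextNbr c i j ∈ tightNbrs c i :=
  nextNbr_mem hj (hc.exists_pos hD3 hi0 hj)

/-- With at least two tight partners, the next partner is a different one. -/
theorem IsGapConfig.nextNbr_ne_self (hc : IsGapConfig c) (hD3 : intruderDist c ^ 2 < 3)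
    {i j : Fin 14} (hi0 : i ≠ 0) (hj : j ∈ tightNbrs c i) (h2 : 2 ≤ (tightNbrs c i).card) :
    nextNbr c i j ≠ j := by
  obtain ⟨k, hd⟩ := hc.exists_card_tightAngles_eq_succ hD3 hi0 ⟨j, hj⟩
  obtain ⟨m, rfl⟩ := hc.exists_tightNbrAt_eq hD3 hi0 hd hj
  rw [nextNbr_tightNbrAt hd m]
  have hk : k ≠ 0 := by
    rw [← hc.card_tightAngles hD3 hi0, hd] at h2
    omega
  exact fun h => finRotate_succ_ne hk m (tightNbrAt_injective c i hd h)

/-- **A gap of at most `π` is the corner between the partner and the next partner**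
(`Bulk/GapCorners.lean`'s `corner c i (nextNbr c i j) j`; admissible, `D² < 3`). So the rows
R-min / R-tri of that file apply to it verbatim. -/
theorem IsGapConfig.dartGap_eq_corner (hc : IsGapConfig c) (hD3 : intruderDist c ^ 2 < 3)
    {i j : Fin 14} (hi0 : i ≠ 0) (hj : j ∈ tightNbrs c i) (hle : dartGap c i j ≤ π) :
    dartGap c i j = corner c i (nextNbr c i j) j := by
  obtain ⟨k, hd⟩ := hc.exists_card_tightAngles_eq_succ hD3 hi0 ⟨j, hj⟩
  obtain ⟨m, rfl⟩ := hc.exists_tightNbrAt_eq hD3 hi0 hd hj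
  rw [dartGap_tightNbrAt] at hle ⊢
  rw [nextNbr_tightNbrAt]
  exact hc.tightGap_eq_corner hD3 hi0 hd m hle

/-! ## Under the census socket: every gap `< π`, `=` the corner, R-min in dart form -/

/-- **Every partner-indexed gap is `< π` under the socket hypothesis** (any vertex `i ≠ 0`). -/
theorem CensusRows.dartGap_lt_pi (h : CensusRows c) {i j : Fin 14} (hi0 : i ≠ 0)
    (hj : j ∈ tightNbrs c i) : dartGap c i j < π := by
  obtain ⟨hD3, -, -⟩ := h.intruderDist_bounds
  obtain ⟨k, hd⟩ := h.isGapConfig.exists_card_tightAngles_eq_succ hD3 hi0 ⟨j, hj⟩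
  obtain ⟨m, rfl⟩ := h.isGapConfig.exists_tightNbrAt_eq hD3 hi0 hd hj
  rw [dartGap_tightNbrAt]
  exact h.tightGap_lt_pi hi0 hd m

/-- Under the socket hypothesis every partner-indexed gap IS the corner between the partner and
the next partner. -/
theorem CensusRows.dartGap_eq_corner (h : CensusRows c) {i j : Fin 14} (hi0 : i ≠ 0)
    (hj : j ∈ tightNbrs c i) : dartGap c i j = corner c i (nextNbr c i j) j :=
  h.isGapConfig.dartGap_eq_corner h.intruderDist_bounds.1 hi0 hj (h.dartGap_lt_pi hi0 hj).le

/-- Under the socket hypothesis: R-sum indexed by partners. -/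
theorem CensusRows.sum_dartGap (h : CensusRows c) {i : Fin 14} (hi0 : i ≠ 0)
    (hne : (tightNbrs c i).Nonempty) : ∑ j ∈ tightNbrs c i, dartGap c i j = 2 * π :=
  h.isGapConfig.sum_dartGap h.intruderDist_bounds.1 hi0 hne

/-- Under the socket hypothesis the next partner is a tight partner … -/
theorem CensusRows.nextNbr_mem_tightNbrs (h : CensusRows c) {i j : Fin 14} (hi0 : i ≠ 0)
    (hj : j ∈ tightNbrs c i) : nextNbr c i j ∈ tightNbrs c i :=
  h.isGapConfig.nextNbr_mem_tightNbrs h.intruderDist_bounds.1 hi0 hj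

/-- … and a different one (every vertex with a partner has `≥ 3` of them). -/
theorem CensusRows.nextNbr_ne_self (h : CensusRows c) {i j : Fin 14} (hi0 : i ≠ 0)
    (hj : j ∈ tightNbrs c i) : nextNbr c i j ≠ j := by
  refine h.isGapConfig.nextNbr_ne_self h.intruderDist_bounds.1 hi0 hj ?_
  have hset : (univ.filter fun j : Fin 14 => j ≠ 0 ∧ j ≠ i ∧ dist (c i) (c j) = 1) =
      tightNbrs c i := rfl
  by_cases hi13 : i = 13
  · subst hi13
    have h3 := h.three_le_card_intruderContacts
    rw [hset] at h3
    omega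
  · have h3 := h.three_le_card_tight i hi0 hi13 ⟨j, mem_tightNbrs.1 hj⟩
    rw [hset] at h3
    omega

/-- **R-min in dart form, shell ball, two shell contacts**: under the socket hypothesis, at a
shell ball `i` whose partner `j` and next partner are both shell balls, the gap after `j` is
`≥ α₀ = arccos (1/3)`. -/
theorem CensusRows.arccos_third_le_dartGap (h : CensusRows c) {i j : Fin 14} (hi0 : i ≠ 0)
    (hi13 : i ≠ 13) (hj : j ∈ tightNbrs c i) (hj13 : j ≠ 13) (hn13 : nextNbr c i j ≠ 13) :
    Real.arccos (1 / 3) ≤ dartGap c i j := by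
  rw [h.dartGap_eq_corner hi0 hj]
  have hn := mem_tightNbrs.1 (h.nextNbr_mem_tightNbrs hi0 hj)
  have hj' := mem_tightNbrs.1 hj
  exact h.arccos_third_le_corner i (nextNbr c i j) j hi0 hi13 hn.1 hn13 hj'.1 hj13 hn.2.2 hj'.2.2
    (h.nextNbr_ne_self hi0 hj)

/-- **R-min in dart form, shell ball, the partner is the hole**: gap `≥ A_x(ρ)`. -/
theorem CensusRows.arccos_Ax_le_dartGap (h : CensusRows c) {i : Fin 14} (hi0 : i ≠ 0)
    (hi13 : i ≠ 13) (hj : (13 : Fin 14) ∈ tightNbrs c i) :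
    Real.arccos (intruderDist c / (√3 * √(4 - intruderDist c ^ 2))) ≤ dartGap c i 13 := by
  rw [h.dartGap_eq_corner hi0 hj]
  have hn := mem_tightNbrs.1 (h.nextNbr_mem_tightNbrs hi0 hj)
  have hn13 : nextNbr c i 13 ≠ 13 := h.nextNbr_ne_self hi0 hj
  exact h.arccos_Ax_le_corner i (nextNbr c i 13) hi0 hi13 hn.1 hn13 hn.2.2 (mem_tightNbrs.1 hj).2.2

/-- **R-min in dart form, shell ball, the next partner is the hole**: gap `≥ A_x(ρ)`. -/
theorem CensusRows.arccos_Ax_le_dartGap' (h : CensusRows c) {i j : Fin 14} (hi0 : i ≠ 0)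
    (hi13 : i ≠ 13) (hj : j ∈ tightNbrs c i) (hn13 : nextNbr c i j = 13) :
    Real.arccos (intruderDist c / (√3 * √(4 - intruderDist c ^ 2))) ≤ dartGap c i j := by
  rw [h.dartGap_eq_corner hi0 hj, hn13, corner_comm]
  have hn := h.nextNbr_mem_tightNbrs hi0 hj
  rw [hn13] at hn
  have hj13 : j ≠ 13 := fun hj13 => h.nextNbr_ne_self hi0 hj (hn13.trans hj13.symm)
  have hj' := mem_tightNbrs.1 hj
  exact h.arccos_Ax_le_corner i j hi0 hi13 hj'.1 hj13 hj'.2.2 (mem_tightNbrs.1 hn).2.2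

/-- **R-min in dart form at the hole**: every gap at the intruder is `≥ A_p(ρ)`. -/
theorem CensusRows.arccos_Ap_le_dartGap (h : CensusRows c) {j : Fin 14}
    (hj : j ∈ tightNbrs c 13) :
    Real.arccos ((2 - intruderDist c ^ 2) / (4 - intruderDist c ^ 2)) ≤ dartGap c 13 j := by
  have h13 : (13 : Fin 14) ≠ 0 := by decide
  rw [h.dartGap_eq_corner h13 hj]
  have hn := mem_tightNbrs.1 (h.nextNbr_mem_tightNbrs h13 hj)
  have hj' := mem_tightNbrs.1 hj
  exact h.arccos_Ap_le_corner (nextNbr c 13 j) j hn.1 hn.2.1 hj'.1 hj'.2.1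
    (by rw [dist_comm]; exact hn.2.2) (by rw [dist_comm]; exact hj'.2.2) (h.nextNbr_ne_self h13 hj)

/-! ## Face corners indexed by darts; total corner sum `= 2π · #active vertices` -/

/-- **The corner of the face through the dart `q = (i, j)` at its head `j`**: the gap at `j`
following the partner `i`, i.e. the angle from the incoming arc `j → i` counter-clockwise to the
outgoing arc `j → nextNbr c j i` of the face walk (`faceSucc c q = (j, nextNbr c j i)`). -/
def faceCorner (c : Fin 14 → EuclideanSpace ℝ (Fin 3)) (q : Fin 14 × Fin 14) : ℝ :=
  dartGap c q.2 q.1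

/-- Unfolding `faceCorner`. -/
theorem faceCorner_eq (c : Fin 14 → EuclideanSpace ℝ (Fin 3)) (q : Fin 14 × Fin 14) :
    faceCorner c q = dartGap c q.2 q.1 := rfl

/-- Face corners are positive. -/
theorem faceCorner_pos (c : Fin 14 → EuclideanSpace ℝ (Fin 3)) (q : Fin 14 × Fin 14) :
    0 < faceCorner c q :=
  dartGap_pos c q.2 q.1

/-- **Under the socket hypothesis the face corner at the head of a dart is the corner between the
incoming and the outgoing arc of the face walk** (`corner c j (faceSucc c q).2 i` for
`q = (i, j)`), and it is `< π`. -/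
theorem CensusRows.faceCorner_eq_corner_faceSucc (h : CensusRows c) {q : Fin 14 × Fin 14}
    (hq : q ∈ darts c) :
    faceCorner c q = corner c q.2 (faceSucc c q).2 q.1 ∧ faceCorner c q < π := by
  have hq' := swap_mem_darts hq
  have hj0 : q.2 ≠ 0 := (mem_darts.1 hq).2.1
  have hi : q.1 ∈ tightNbrs c q.2 := by
    have := snd_mem_tightNbrs_of_mem_darts hq'
    simpa only [Prod.fst_swap, Prod.snd_swap] using this
  exact ⟨h.dartGap_eq_corner hj0 hi, h.dartGap_lt_pi hj0 hi⟩

/-- **The active vertices** of the tight map: balls `≠ 0` with at least one tight partner (the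
non-rattler shell balls and the hole — the vertex set `V(T′)` of the cell's files). -/
def activeVertices (c : Fin 14 → EuclideanSpace ℝ (Fin 3)) : Finset (Fin 14) :=
  univ.filter fun i => i ≠ 0 ∧ (tightNbrs c i).Nonempty

/-- Membership in `activeVertices`. -/
theorem mem_activeVertices {i : Fin 14} :
    i ∈ activeVertices c ↔ i ≠ 0 ∧ (tightNbrs c i).Nonempty := by
  simp [activeVertices]

/-- The darts with head `j` correspond to the tight partners of `j`: summing a function of the
tail over them is summing over `tightNbrs c j`. -/
theorem sum_darts_filter_snd (c : Fin 14 → EuclideanSpace ℝ (Fin 3)) (j : Fin 14) (hj0 : j ≠ 0)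
    (f : Fin 14 → ℝ) :
    ∑ q ∈ (darts c).filter (fun q => q.2 = j), f q.1 = ∑ i ∈ tightNbrs c j, f i := by
  refine Finset.sum_nbij (fun q => q.1) ?_ ?_ ?_ (fun q _ => rfl)
  · intro q hq
    rw [Finset.mem_filter] at hq
    obtain ⟨hq, rfl⟩ := hq
    have := snd_mem_tightNbrs_of_mem_darts (swap_mem_darts hq)
    simpa only [Prod.fst_swap, Prod.snd_swap] using this
  · intro q hq q' hq' hh
    rw [Finset.mem_coe, Finset.mem_filter] at hq hq'
    exact Prod.ext hh (hq.2.trans hq'.2.symm)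
  · intro i hi
    rw [Finset.mem_coe] at hi
    refine ⟨(i, j), ?_, rfl⟩
    rw [Finset.mem_coe, Finset.mem_filter]
    exact ⟨swap_mem_darts (mk_mem_darts hj0 hi), rfl⟩

/-- A ball with no tight partner heads no dart. -/
theorem darts_filter_snd_eq_empty {j : Fin 14} (hj : ¬ (tightNbrs c j).Nonempty) :
    (darts c).filter (fun q => q.2 = j) = ∅ := by
  rw [Finset.filter_eq_empty_iff]
  rintro q hq rfl
  have := snd_mem_tightNbrs_of_mem_darts (swap_mem_darts hq)
  simp only [Prod.fst_swap, Prod.snd_swap] at this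
  exact hj ⟨q.1, this⟩

/-- **Total corner sum: `Σ_{q ∈ darts c} faceCorner c q = 2π · #activeVertices c`** (admissible,
`intruderDist² < 3`) — summing the face corners over all darts is summing the gaps vertex by
vertex, `2π` at every active vertex (R-sum). This is the angle side of Euler's formula /
Gauss–Bonnet for the tight map (`Σ_faces Σ_corners = 2π · V′`). -/
theorem IsGapConfig.sum_faceCorner (hc : IsGapConfig c) (hD3 : intruderDist c ^ 2 < 3) :
    ∑ q ∈ darts c, faceCorner c q = 2 * π * (activeVertices c).card := by
  classical
  have hmaps : ∀ q ∈ darts c, q.2 ∈ (univ.filter fun j : Fin 14 => j ≠ 0) :=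
    fun q hq => Finset.mem_filter.2 ⟨Finset.mem_univ _, (mem_darts.1 hq).2.1⟩
  rw [← Finset.sum_fiberwise_of_maps_to hmaps]
  have hinner : ∀ j ∈ (univ.filter fun j : Fin 14 => j ≠ 0),
      ∑ q ∈ (darts c).filter (fun q => q.2 = j), faceCorner c q =
        if (tightNbrs c j).Nonempty then 2 * π else 0 := by
    intro j hj
    have hj0 : j ≠ 0 := (Finset.mem_filter.1 hj).2
    split_ifs with hne
    · have h1 : ∑ q ∈ (darts c).filter (fun q => q.2 = j), faceCorner c q =
          ∑ q ∈ (darts c).filter (fun q => q.2 = j), dartGap c j q.1 := by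
        refine Finset.sum_congr rfl fun q hq => ?_
        rw [faceCorner_eq, (Finset.mem_filter.1 hq).2]
      rw [h1, sum_darts_filter_snd c j hj0 (fun i => dartGap c j i)]
      exact hc.sum_dartGap hD3 hj0 hne
    · rw [darts_filter_snd_eq_empty hne, Finset.sum_empty]
  rw [Finset.sum_congr rfl hinner, Finset.sum_ite, Finset.sum_const_zero, add_zero,
    Finset.sum_const, nsmul_eq_mul, mul_comm]
  congr 2
  rw [Finset.filter_filter]
  rfl

/-- Under the socket hypothesis: the total corner sum is `2π · #activeVertices c`. -/
theorem CensusRows.sum_faceCorner (h : CensusRows c) :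
    ∑ q ∈ darts c, faceCorner c q = 2 * π * (activeVertices c).card :=
  h.isGapConfig.sum_faceCorner h.intruderDist_bounds.1

end Summit.Ventures.Crystal3D
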